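import Literature.NumberTheory.Sieve.GallagherSingularSeries
import Literature.NumberTheory.Sieve.GoldstonPintzYildirim
import Literature.NumberTheory.Sieve.GoldstonPintzYildirimDivisorSums
import Mathlib.Data.Nat.GCD.BigOperators
import HarnessLib

/-!
# Goldston–Pintz–Yıldırım, *Primes in tuples I*, §6: `ν_d(H)`, the count (6.4), and (6.3)–(6.5)

Trunk: NumberTheory / Sieve. The arithmetic opening of the proof of GPY Proposition 1
(D. A. Goldston, J. Pintz, C. Y. Yıldırım, *Primes in tuples. I*, Ann. of Math. 170 (2009) =
arXiv:math/0508185, §6, p. 12), for the objects `tuplePoly`/`lambdaR` of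
`Literature.NumberTheory.Sieve.GoldstonPintzYildirim`.
Everything here is PROVED.

* `Literature.GPY.nuPrime H p = ν_p(H)`, `Literature.GPY.nu H d = ν_d(H) = ∏_{p ∣ d} ν_p(H)` (squarefree `d`);
  `nu_le_pow` — `ν_q(H) ≤ k^{ω(q)} = d_k(q)`;
* `card_filter_range_dvd_tuplePoly` — for squarefree `d` there are exactly `ν_d(H)` residues
  `n (mod d)` with `d ∣ P_H(n)` (CRT, `sum_range_prod_eq_prod_sum`);
* `abs_card_filter_dvd_tuplePoly_sub_le` — **(6.4)**:
  `|#{1 ≤ n ≤ N : d ∣ P_H(n)} − ν_d(H) N/d| ≤ ν_d(H)`;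
* `sum_lambdaR_eq` — **(6.3)**; `mainTR R H ℓ = T_R(N; H)`;
* `abs_sum_lambdaR_sub_le`, `abs_sum_lambdaR_sub_le'` — **(6.5)**:
  `|∑_{n ≤ N} Λ_R(n; H, ℓ) − N T_R| ≤ ((log R)^{k+ℓ}/(k+ℓ)!) ∑♭_{d ≤ R} d_k(d)`
  `≤ ((log R)^{k+ℓ}/(k+ℓ)!) R (k + log R)^k`
  (Lemma 2, (5.12), from `GoldstonPintzYildirimDivisorSums`).

The one-variable periodic-sum and CRT lemmas (`sum_Ico_of_periodic`, `sum_filter_mod_eq`,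
`sum_range_prod_eq_prod_sum`) are the `k = 1` shapes of the `Fin k`-indexed ones of
`Literature.NumberTheory.Sieve.GallagherSingularSeries`, whose `card_filter_Ico_mod_eq` is reused.
Next step of the source (not here): (6.6)–(6.7), `T_R` as `(1/2πi)∫_(1) F(s) R^s s^{-k-1} ds` with
`F(s) = ∑ μ(d)ν_d(H) d^{-1-s} = ∏_p (1 − ν_p(H) p^{-1-s})`.

## References

* D. A. Goldston, J. Pintz, C. Y. Yıldırım, *Primes in tuples. I*, Ann. of Math. (2) 170 (2009),
  819–862 = arXiv:math/0508185, §6, (6.3)–(6.5), p. 12; §2, (2.2), (2.8), (2.13).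
  [cite: GoldstonPintzYildirim2009]
-/

noncomputable section

open Finset
open scoped ArithmeticFunction.Moebius ArithmeticFunction.omega

namespace Literature.NumberTheory.Sieve.GPY


/-- The sum of an `n`-periodic function over `[a, a + m n)` is `m` times its sum over one period
(one-variable form of `Literature.NumberTheory.Sieve.Gallagher.sum_piFinset_Ico_of_periodic`). [folklore] -/
theorem sum_Ico_of_periodic {n : ℕ} (hn : 0 < n) (a m : ℕ) (f : ℕ → ℝ)
    (hf : ∀ t, f (t % n) = f t) :
    ∑ t ∈ Ico a (a + m * n), f t = (m : ℝ) * ∑ u ∈ range n, f u := by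
  have hmaps : ∀ t ∈ Ico a (a + m * n), t % n ∈ range n :=
    fun t _ => mem_range.2 (Nat.mod_lt _ hn)
  rw [← Finset.sum_fiberwise_of_maps_to hmaps, Finset.mul_sum]
  refine Finset.sum_congr rfl fun u hu => ?_
  have hval : ∀ t ∈ (Ico a (a + m * n)).filter (fun t => t % n = u), f t = f u := by
    intro t ht
    rw [← hf t, (mem_filter.1 ht).2]
  rw [Finset.sum_congr rfl hval, Finset.sum_const, nsmul_eq_mul,
    Gallagher.card_filter_Ico_mod_eq hn (mem_range.1 hu)]

/-- An `n`-periodic predicate holds on `[a, a + m n)` exactly `m · #{u < n : P u}` times ("for each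
solution one has `n` running through a residue class modulo `d`", GPY §6 before (6.4)).
[folklore] -/
theorem card_filter_Ico_of_periodic {n : ℕ} (hn : 0 < n) (a m : ℕ) (P : ℕ → Prop) [DecidablePred P]
    (hP : ∀ t, P (t % n) ↔ P t) :
    #((Ico a (a + m * n)).filter P) = m * #((range n).filter P) := by
  have h := sum_Ico_of_periodic hn a m (fun t => if P t then (1 : ℝ) else 0) (fun t => by
    by_cases ht : P t
    · rw [if_pos ht, if_pos ((hP t).2 ht)]
    · rw [if_neg ht, if_neg (fun h => ht ((hP t).1 h))])
  rw [Finset.sum_boole, Finset.sum_boole] at h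
  exact_mod_cast h

/-- Chinese remainder theorem on a fibre (one-variable form of
`Literature.NumberTheory.Sieve.Gallagher.sum_filter_modVec_eq`):
for coprime `p`, `P'`, on `{t < p P' : t ≡ u (P')}` reduction mod `p` is a bijection onto `[0, p)`,
so a `p`-periodic function has the same sum over the fibre as over one period. [folklore] -/
theorem sum_filter_mod_eq {p P' : ℕ} (hp : 0 < p) (hP' : 0 < P') (hcop : Nat.Coprime p P')
    (g : ℕ → ℝ) (hg : ∀ t, g (t % p) = g t) {u : ℕ} (hu : u < P') :
    ∑ t ∈ (range (p * P')).filter (fun t => t % P' = u), g t = ∑ x ∈ range p, g x := by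
  set Φ := (range (p * P')).filter (fun t => t % P' = u) with hΦ
  have hcardΦ : #Φ = p := by
    have := Gallagher.card_filter_Ico_mod_eq (a := 0) (m := p) hP' hu
    rwa [zero_add, ← Finset.range_eq_Ico] at this
  have hinj : Set.InjOn (fun t => t % p) (Φ : Set ℕ) := by
    intro t ht t' ht' heq
    rw [hΦ, coe_filter, Set.mem_setOf_eq, mem_range] at ht ht'
    have h2 : t % P' = t' % P' := by rw [ht.2, ht'.2]
    have h12 : t ≡ t' [MOD p * P'] := (Nat.modEq_and_modEq_iff_modEq_mul hcop).1 ⟨heq, h2⟩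
    exact Nat.ModEq.eq_of_lt_of_lt h12 ht.1 ht'.1
  have himage : Φ.image (fun t => t % p) = range p := by
    apply Finset.eq_of_subset_of_card_le
    · intro x hx
      obtain ⟨t, -, rfl⟩ := mem_image.1 hx
      exact mem_range.2 (Nat.mod_lt _ hp)
    · rw [Finset.card_image_of_injOn hinj, hcardΦ, card_range]
  calc ∑ t ∈ Φ, g t = ∑ t ∈ Φ, g (t % p) := Finset.sum_congr rfl fun t _ => (hg t).symm
    _ = ∑ x ∈ Φ.image (fun t => t % p), g x := (Finset.sum_image hinj).symm
    _ = _ := by rw [himage]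

/-- Independence of periodic factors at distinct primes (one-variable form of
`Literature.NumberTheory.Sieve.Gallagher.sum_prod_localFactor`): for a finite set `S` of primes with product `P_S` and
`p`-periodic `g p`, `∑_{r < P_S} ∏_{p ∈ S} g p r = ∏_{p ∈ S} ∑_{x < p} g p x` — the
"multiplicativity" behind `ν_d(H)` in GPY §6. [folklore] -/
theorem sum_range_prod_eq_prod_sum (S : Finset ℕ) (hS : ∀ p ∈ S, p.Prime) (g : ℕ → ℕ → ℝ)
    (hg : ∀ p ∈ S, ∀ t, g p (t % p) = g p t) :
    ∑ r ∈ range (∏ p ∈ S, p), ∏ p ∈ S, g p r = ∏ p ∈ S, ∑ x ∈ range p, g p x := by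
  induction S using Finset.induction_on with
  | empty => simp
  | insert p S hpS ih =>
    have hp : p.Prime := hS p (mem_insert_self _ _)
    have hS' : ∀ q ∈ S, q.Prime := fun q hq => hS q (mem_insert_of_mem hq)
    have hg' : ∀ q ∈ S, ∀ t, g q (t % q) = g q t := fun q hq => hg q (mem_insert_of_mem hq)
    have ih' := ih hS' hg'
    have hP'pos : 0 < ∏ q ∈ S, q := Finset.prod_pos fun q hq => (hS' q hq).pos
    have hcop : Nat.Coprime p (∏ q ∈ S, q) :=
      Nat.Coprime.prod_right fun q hq =>
        (Nat.coprime_primes hp (hS' q hq)).2 fun h => hpS (h ▸ hq)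
    rw [Finset.prod_insert hpS, Finset.prod_insert hpS]
    simp_rw [Finset.prod_insert hpS]
    -- the product over `S` is `P'`-periodic
    have hper : ∀ r, ∏ q ∈ S, g q (r % ∏ q ∈ S, q) = ∏ q ∈ S, g q r := by
      intro r
      refine Finset.prod_congr rfl fun q hq => ?_
      rw [← hg' q hq (r % ∏ q ∈ S, q), Nat.mod_mod_of_dvd r (Finset.dvd_prod_of_mem _ hq), hg' q hq]
    have hmaps : ∀ r ∈ range (p * ∏ q ∈ S, q), r % (∏ q ∈ S, q) ∈ range (∏ q ∈ S, q) :=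
      fun r _ => mem_range.2 (Nat.mod_lt _ hP'pos)
    rw [← Finset.sum_fiberwise_of_maps_to hmaps]
    have hinner : ∀ u ∈ range (∏ q ∈ S, q),
        ∑ r ∈ (range (p * ∏ q ∈ S, q)).filter (fun r => r % (∏ q ∈ S, q) = u),
          g p r * ∏ q ∈ S, g q r = (∑ x ∈ range p, g p x) * ∏ q ∈ S, g q u := by
      intro u hu
      have hF : ∀ r ∈ (range (p * ∏ q ∈ S, q)).filter (fun r => r % (∏ q ∈ S, q) = u),
          ∏ q ∈ S, g q r = ∏ q ∈ S, g q u := by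
        intro r hr
        rw [← hper r, (mem_filter.1 hr).2]
      rw [Finset.sum_congr rfl fun r hr => by rw [hF r hr], ← Finset.sum_mul,
        sum_filter_mod_eq hp.pos hP'pos hcop (g p) (hg p (mem_insert_self _ _)) (mem_range.1 hu)]
    rw [Finset.sum_congr rfl hinner, ← Finset.mul_sum, ih']

/-! ### `ν_p(H)` and `ν_d(H)` -/

/-- `ν_p(H)` for a tuple `H` of natural numbers: the number of distinct residue classes modulo `p`
occupied by `H` (GPY p. 6 before (2.2); equals `Literature.NumberTheory.Sieve.tupleResidueCount` of the cast tuple,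
`tupleResidueCount_image_cast`). [cite: GoldstonPintzYildirim2009, Section 2 eq. 2.2] -/
def nuPrime (H : Finset ℕ) (p : ℕ) : ℕ := #(H.image fun h => h % p)

/-- `ν_d(H) = ∏_{p ∣ d} ν_p(H)`: the extension of `ν_p(H)` to squarefree `d` by multiplicativity
(GPY §6, before (6.4): "for `d` squarefree we then have by multiplicativity `ν_d(H)` distinct
solutions for `n` modulo `d` which satisfy `d ∣ P_H(n)`"; junk on non-squarefree `d`, where only
`μ(d) ν_d(H) = 0` is ever used). [cite: GoldstonPintzYildirim2009, Section 6 eq. 6.4] -/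
def nu (H : Finset ℕ) (d : ℕ) : ℕ := ∏ p ∈ d.primeFactors, nuPrime H p

/-- `ν_p(H) ≤ k = #H`. [folklore] -/
theorem nuPrime_le_card (H : Finset ℕ) (p : ℕ) : nuPrime H p ≤ #H := Finset.card_image_le

/-- Bridge: `ν_p` of the cast tuple `H ⊆ ℤ` (`Literature.NumberTheory.Sieve.tupleResidueCount`) is `nuPrime H p`.
[folklore] -/
theorem tupleResidueCount_image_cast {p : ℕ} (hp : p.Prime) (H : Finset ℕ) :
    tupleResidueCount (H.image ((↑) : ℕ → ℤ)) p = nuPrime H p := by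
  haveI := NeZero.mk hp.ne_zero
  unfold tupleResidueCount nuPrime
  rw [Finset.image_image]
  have : (H.image fun h => h % p) =
      (H.image ((fun h : ℤ => (h : ZMod p)) ∘ ((↑) : ℕ → ℤ))).image ZMod.val := by
    rw [Finset.image_image]
    refine Finset.image_congr fun h _ => ?_
    simp [Function.comp, ZMod.val_natCast]
  rw [this, Finset.card_image_of_injective _ (ZMod.val_injective p)]

/-- "Trivially `ν_q(H) ≤ k^{ω(q)} = d_k(q)` for squarefree `q`" (GPY §6 after (6.4); here for all
`q`, with `ω(q) = #primeFactors q`). [cite: GoldstonPintzYildirim2009, Section 6 eq. 6.5] -/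
theorem nu_le_pow (H : Finset ℕ) (d : ℕ) : nu H d ≤ #H ^ d.primeFactors.card := by
  unfold nu
  calc ∏ p ∈ d.primeFactors, nuPrime H p ≤ ∏ _p ∈ d.primeFactors, #H :=
        Finset.prod_le_prod' fun p _ => nuPrime_le_card H p
    _ = #H ^ d.primeFactors.card := by rw [Finset.prod_const]

/-! ### Divisibility of `P_H(n)` -/

/-- `p ∣ P_H(n) ↔ p ∣ n + h` for some `h ∈ H` (`p` prime). [folklore] -/
theorem prime_dvd_tuplePoly_iff {p : ℕ} (hp : p.Prime) (H : Finset ℕ) (n : ℕ) :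
    p ∣ tuplePoly H n ↔ ∃ h ∈ H, p ∣ n + h := by
  unfold tuplePoly
  exact Prime.dvd_finsetProd_iff hp.prime _

/-- `P_H(n) mod p` depends only on `n mod p`. [folklore] -/
theorem tuplePoly_mod (H : Finset ℕ) (p n : ℕ) : tuplePoly H (n % p) % p = tuplePoly H n % p := by
  unfold tuplePoly
  rw [Finset.prod_nat_mod, Finset.prod_nat_mod (s := H) (f := fun h => n + h)]
  congr 1
  refine Finset.prod_congr rfl fun h _ => ?_
  rw [Nat.add_mod, Nat.mod_mod, ← Nat.add_mod]

/-- `p ∣ P_H(n)` is `p`-periodic in `n`. [folklore] -/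
theorem prime_dvd_tuplePoly_mod_iff (H : Finset ℕ) (p n : ℕ) :
    p ∣ tuplePoly H (n % p) ↔ p ∣ tuplePoly H n := by
  rw [Nat.dvd_iff_mod_eq_zero, Nat.dvd_iff_mod_eq_zero, tuplePoly_mod]

/-- For squarefree `d`: `d ∣ m ↔ p ∣ m` for every prime `p ∣ d`. [folklore] -/
theorem squarefree_dvd_iff {d : ℕ} (hd : Squarefree d) (m : ℕ) :
    d ∣ m ↔ ∀ p ∈ d.primeFactors, p ∣ m := by
  constructor
  · intro h p hp
    exact (Nat.dvd_of_mem_primeFactors hp).trans h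
  · intro h
    rw [← Nat.prod_primeFactors_of_squarefree hd]
    exact Finset.prod_primes_dvd m (fun p hp => (Nat.prime_of_mem_primeFactors hp).prime) h

/-- "If for a prime `p` we have `p ∣ P_H(n)`, then among the solutions `n ≡ −hᵢ (mod p)` there will
be `ν_p(H)` distinct solutions modulo `p`" (GPY §6): `#{r < p : p ∣ P_H(r)} = ν_p(H)` (negation is a
bijection of `ℤ/p`). [cite: GoldstonPintzYildirim2009, Section 6 eq. 6.4] -/
theorem card_filter_range_prime_dvd {p : ℕ} (hp : p.Prime) (H : Finset ℕ) :
    #((range p).filter fun r => p ∣ tuplePoly H r) = nuPrime H p := by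
  haveI := Fact.mk hp
  rw [← tupleResidueCount_image_cast hp, tupleResidueCount, Finset.image_image]
  have hR : (H.image ((fun h : ℤ => (h : ZMod p)) ∘ ((↑) : ℕ → ℤ))) =
      H.image fun h : ℕ => (h : ZMod p) := by
    refine Finset.image_congr fun h _ => ?_
    simp
  rw [hR]
  have hneg : #(H.image fun h : ℕ => -(h : ZMod p)) = #(H.image fun h : ℕ => (h : ZMod p)) := by
    have : (H.image fun h : ℕ => -(h : ZMod p)) =
        (H.image fun h : ℕ => (h : ZMod p)).image Neg.neg := by
      rw [Finset.image_image]
      rfl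
    rw [this, Finset.card_image_of_injective _ neg_injective]
  rw [← hneg]
  have hinj : Set.InjOn (fun r : ℕ => (r : ZMod p))
      ((range p).filter fun r => p ∣ tuplePoly H r : Set ℕ) := by
    intro a ha b hb hab
    have ha' := mem_range.1 (mem_filter.1 (Finset.mem_coe.1 ha)).1
    have hb' := mem_range.1 (mem_filter.1 (Finset.mem_coe.1 hb)).1
    have := congrArg ZMod.val hab
    simp only at this
    rwa [ZMod.val_cast_of_lt ha', ZMod.val_cast_of_lt hb'] at this
  rw [← Finset.card_image_of_injOn hinj]
  congr 1
  ext x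
  simp only [mem_image, mem_filter, mem_range, prime_dvd_tuplePoly_iff hp]
  constructor
  · rintro ⟨r, ⟨-, h, hh, hdvd⟩, rfl⟩
    refine ⟨h, hh, ?_⟩
    have : ((r + h : ℕ) : ZMod p) = 0 := (ZMod.natCast_eq_zero_iff _ _).2 hdvd
    push_cast at this
    exact (eq_neg_of_add_eq_zero_left this).symm
  · rintro ⟨h, hh, rfl⟩
    refine ⟨(-(h : ZMod p)).val, ⟨ZMod.val_lt _, h, hh, ?_⟩, ZMod.natCast_zmod_val _⟩
    rw [← ZMod.natCast_eq_zero_iff]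
    push_cast
    rw [ZMod.natCast_zmod_val]
    ring

/-- "For `d` squarefree we then have by multiplicativity `ν_d(H)` distinct solutions for `n` modulo
`d`" (GPY §6): `#{r < d : d ∣ P_H(r)} = ν_d(H)`, by `sum_range_prod_eq_prod_sum` applied to the
indicators of `p ∣ P_H(r)`, `p ∣ d`. [cite: GoldstonPintzYildirim2009, Section 6 eq. 6.4] -/
theorem card_filter_range_dvd_tuplePoly {d : ℕ} (hd : Squarefree d) (H : Finset ℕ) :
    #((range d).filter fun r => d ∣ tuplePoly H r) = nu H d := by
  classical
  set S := d.primeFactors with hSdef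
  have hS : ∀ p ∈ S, p.Prime := fun p hp => Nat.prime_of_mem_primeFactors hp
  have hprod : ∏ p ∈ S, p = d := Nat.prod_primeFactors_of_squarefree hd
  set g : ℕ → ℕ → ℝ := fun p r => if p ∣ tuplePoly H r then 1 else 0 with hgdef
  have hg : ∀ p ∈ S, ∀ t, g p (t % p) = g p t := by
    intro p _ t
    simp only [hgdef, prime_dvd_tuplePoly_mod_iff]
  have key := sum_range_prod_eq_prod_sum S hS g hg
  rw [hprod] at key
  have hL : ∀ r, ∏ p ∈ S, g p r = if d ∣ tuplePoly H r then 1 else 0 := by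
    intro r
    simp only [hgdef]
    rw [Finset.prod_boole]
    congr 1
    exact propext (squarefree_dvd_iff hd _).symm
  have hRp : ∀ p ∈ S, ∑ x ∈ range p, g p x = nuPrime H p := by
    intro p hp
    simp only [hgdef]
    rw [Finset.sum_boole, card_filter_range_prime_dvd (hS p hp)]
  simp_rw [hL] at key
  rw [Finset.sum_boole, Finset.prod_congr rfl hRp] at key
  unfold nu
  exact_mod_cast key

/-- `d ∣ P_H(n)` is `d`-periodic in `n` (squarefree `d`). [folklore] -/
theorem dvd_tuplePoly_mod_iff {d : ℕ} (hd : Squarefree d) (H : Finset ℕ) (t : ℕ) :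
    d ∣ tuplePoly H (t % d) ↔ d ∣ tuplePoly H t := by
  rw [squarefree_dvd_iff hd, squarefree_dvd_iff hd]
  refine forall₂_congr fun p hp => ?_
  rw [← prime_dvd_tuplePoly_mod_iff H p (t % d),
    Nat.mod_mod_of_dvd t (Nat.dvd_of_mem_primeFactors hp), prime_dvd_tuplePoly_mod_iff]

/-- **GPY (6.4)**, two-sided: for squarefree `d`,
`⌊N/d⌋ ν_d(H) ≤ #{1 ≤ n ≤ N : d ∣ P_H(n)} ≤ (⌊N/d⌋ + 1) ν_d(H)` (the cube `[1, N]` lies between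
`⌊N/d⌋` and `⌊N/d⌋ + 1` full periods). [cite: GoldstonPintzYildirim2009, Section 6 eq. 6.4] -/
theorem card_filter_Icc_dvd_tuplePoly_bounds {d : ℕ} (hd : Squarefree d) (H : Finset ℕ) (N : ℕ) :
    N / d * nu H d ≤ #((Icc 1 N).filter fun n => d ∣ tuplePoly H n) ∧
      #((Icc 1 N).filter fun n => d ∣ tuplePoly H n) ≤ (N / d + 1) * nu H d := by
  classical
  have hd0 : 0 < d := Nat.pos_of_ne_zero hd.ne_zero
  have hper : ∀ a m : ℕ, #((Ico a (a + m * d)).filter fun n => d ∣ tuplePoly H n) = m * nu H d := by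
    intro a m
    rw [card_filter_Ico_of_periodic hd0 a m (fun n => d ∣ tuplePoly H n)
      (fun t => dvd_tuplePoly_mod_iff hd H t), card_filter_range_dvd_tuplePoly hd]
  have hqd : N / d * d ≤ N := Nat.div_mul_le_self N d
  have hlt : N < (N / d + 1) * d := by
    rw [Nat.add_mul, one_mul]
    exact Nat.lt_div_mul_add hd0
  constructor
  · rw [← hper 1 (N / d)]
    exact card_le_card (filter_subset_filter _ fun x hx => by
      rw [Finset.mem_Ico] at hx; rw [Finset.mem_Icc]; omega)
  · rw [← hper 1 (N / d + 1)]
    exact card_le_card (filter_subset_filter _ fun x hx => by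
      rw [Finset.mem_Icc] at hx; rw [Finset.mem_Ico]; omega)

/-- **GPY (6.4)**: `∑_{1 ≤ n ≤ N, d ∣ P_H(n)} 1 = ν_d(H) (N/d + O(1))` for squarefree `d`, with the
`O(1)` explicit: `|#{1 ≤ n ≤ N : d ∣ P_H(n)} − ν_d(H) N/d| ≤ ν_d(H)`.
[cite: GoldstonPintzYildirim2009, Section 6 eq. 6.4] -/
theorem abs_card_filter_dvd_tuplePoly_sub_le {d : ℕ} (hd : Squarefree d) (H : Finset ℕ) (N : ℕ) :
    |(#((Icc 1 N).filter fun n => d ∣ tuplePoly H n) : ℝ) - nu H d * ((N : ℝ) / d)| ≤ nu H d := by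
  obtain ⟨h1, h2⟩ := card_filter_Icc_dvd_tuplePoly_bounds hd H N
  have hd0 : 0 < d := Nat.pos_of_ne_zero hd.ne_zero
  have hd0' : (0 : ℝ) < d := by exact_mod_cast hd0
  have h1' : ((N / d : ℕ) : ℝ) * nu H d ≤ #((Icc 1 N).filter fun n => d ∣ tuplePoly H n) := by
    exact_mod_cast h1
  have h2' : (#((Icc 1 N).filter fun n => d ∣ tuplePoly H n) : ℝ) ≤ ((N / d : ℕ) + 1) * nu H d := by
    exact_mod_cast h2
  -- `N/d − 1 < ⌊N/d⌋ ≤ N/d`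
  have hfloor : ((N / d : ℕ) : ℝ) ≤ (N : ℝ) / d := Nat.cast_div_le
  have hfloor' : (N : ℝ) / d - 1 < ((N / d : ℕ) : ℝ) := by
    have : (N : ℝ) / d - 1 < ((N / d : ℕ) : ℝ) := by
      have h := Nat.lt_div_mul_add hd0 (a := N)
      have h' : (N : ℝ) < ((N / d : ℕ) : ℝ) * d + d := by exact_mod_cast h
      rw [div_sub_one hd0'.ne', div_lt_iff₀ hd0']
      linarith
    exact this
  have hν : (0 : ℝ) ≤ nu H d := Nat.cast_nonneg _
  rw [abs_le]
  constructor <;> nlinarith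

/-! ### (6.3) and (6.5): `S_R(N; H) = N T_R(N; H) + O(R (k + log R)^{2k})` -/

/-- For `n ≥ 1` the divisors `d ≤ R` of `P_H(n)` (the range of the sum defining `Λ_R(n; H, ℓ)`,
(2.13)) are the `1 ≤ d ≤ ⌊R⌋` with `d ∣ P_H(n)`. [folklore] -/
theorem divisors_filter_eq (H : Finset ℕ) {n : ℕ} (hn : 1 ≤ n) (R : ℝ) :
    (tuplePoly H n).divisors.filter (fun d : ℕ => (d : ℝ) ≤ R) =
      (Icc 1 ⌊R⌋₊).filter (fun d => d ∣ tuplePoly H n) := by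
  have hP : tuplePoly H n ≠ 0 := by
    unfold tuplePoly
    exact Finset.prod_ne_zero_iff.2 fun h _ => by omega
  ext d
  simp only [mem_filter, Nat.mem_divisors, mem_Icc]
  constructor
  · rintro ⟨⟨hd, -⟩, hdR⟩
    have hd1 : 1 ≤ d := Nat.pos_of_dvd_of_pos hd (Nat.pos_of_ne_zero hP)
    exact ⟨⟨hd1, Nat.le_floor hdR⟩, hd⟩
  · rintro ⟨⟨hd1, hdR⟩, hd⟩
    refine ⟨⟨hd, hP⟩, ?_⟩
    calc (d : ℝ) ≤ ⌊R⌋₊ := by exact_mod_cast hdR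
      _ ≤ R := Nat.floor_le (by
          have : (1 : ℝ) ≤ ⌊R⌋₊ := by exact_mod_cast hd1.trans hdR
          have := Nat.floor_pos.1 (show 0 < ⌊R⌋₊ by exact_mod_cast hd1.trans hdR)
          linarith)

/-- **GPY (6.3)** (for any `ℓ`; the source takes `ℓ = 0`): `S_R(N; H) := ∑_{n=1}^N Λ_R(n; H, ℓ) =
(1/(k+ℓ)!) ∑_{d ≤ R} μ(d) (log R/d)^{k+ℓ} ∑_{1 ≤ n ≤ N, d ∣ P_H(n)} 1`.
[cite: GoldstonPintzYildirim2009, Section 6 eq. 6.3] -/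
theorem sum_lambdaR_eq (R : ℝ) (H : Finset ℕ) (ℓ N : ℕ) :
    ∑ n ∈ Icc 1 N, lambdaR R H ℓ n = ((#H + ℓ).factorial : ℝ)⁻¹ *
      ∑ d ∈ Icc 1 ⌊R⌋₊, (μ d : ℝ) * Real.log (R / d) ^ (#H + ℓ) *
        #((Icc 1 N).filter fun n => d ∣ tuplePoly H n) := by
  unfold lambdaR
  rw [← Finset.mul_sum]
  congr 1
  have h1 : ∀ n ∈ Icc 1 N,
      ∑ d ∈ (tuplePoly H n).divisors.filter (fun d : ℕ => (d : ℝ) ≤ R),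
        (μ d : ℝ) * Real.log (R / d) ^ (#H + ℓ) =
      ∑ d ∈ Icc 1 ⌊R⌋₊,
        if d ∣ tuplePoly H n then (μ d : ℝ) * Real.log (R / d) ^ (#H + ℓ) else 0 := by
    intro n hn
    rw [divisors_filter_eq H (Finset.mem_Icc.1 hn).1 R, Finset.sum_filter]
  rw [Finset.sum_congr rfl h1, Finset.sum_comm]
  refine Finset.sum_congr rfl fun d _ => ?_
  rw [← Finset.sum_filter, Finset.sum_const, nsmul_eq_mul, mul_comm]

/-- `T_R(N; H)` of (6.5)/(6.7): `(1/(k+ℓ)!) ∑_{d ≤ R} μ(d) ν_d(H)/d · (log R/d)^{k+ℓ}` (it does not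
depend on `N`; for `ℓ = 0` it is the printed `T_R(N; H)`, which (6.7) rewrites as the contour
integral `(1/2πi) ∫_(1) F(s) R^s s^{−k−1} ds`).
[cite: GoldstonPintzYildirim2009, Section 6 eq. 6.5] -/
def mainTR (R : ℝ) (H : Finset ℕ) (ℓ : ℕ) : ℝ :=
  ((#H + ℓ).factorial : ℝ)⁻¹ *
    ∑ d ∈ Icc 1 ⌊R⌋₊, (μ d : ℝ) * Real.log (R / d) ^ (#H + ℓ) * (nu H d / d : ℝ)

/-- **GPY (6.5)**, explicit: `|S_R(N; H) − N T_R(N; H)| ≤ ((log R)^{k+ℓ}/(k+ℓ)!) ∑♭_{d ≤ R} d_k(d)`,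
from (6.4), `ν_d(H) ≤ d_k(d)`, `|μ| ≤ 1` and `0 ≤ log(R/d) ≤ log R` (`R ≥ 1`).
[cite: GoldstonPintzYildirim2009, Section 6 eq. 6.5] -/
theorem abs_sum_lambdaR_sub_le {R : ℝ} (hR : 1 ≤ R) (H : Finset ℕ) (ℓ N : ℕ) :
    |∑ n ∈ Icc 1 N, lambdaR R H ℓ n - N * mainTR R H ℓ| ≤
      ((#H + ℓ).factorial : ℝ)⁻¹ * Real.log R ^ (#H + ℓ) * sumDGen R #H := by
  rw [sum_lambdaR_eq, mainTR, mul_left_comm, ← mul_sub, Finset.mul_sum, ← Finset.sum_sub_distrib,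
    abs_mul, abs_of_nonneg (by positivity), mul_assoc]
  apply mul_le_mul_of_nonneg_left _ (by positivity)
  -- termwise
  have hlogR : 0 ≤ Real.log R := Real.log_nonneg hR
  calc |∑ d ∈ Icc 1 ⌊R⌋₊, ((μ d : ℝ) * Real.log (R / d) ^ (#H + ℓ) *
          #((Icc 1 N).filter fun n => d ∣ tuplePoly H n) -
          N * ((μ d : ℝ) * Real.log (R / d) ^ (#H + ℓ) * (nu H d / d : ℝ)))|
      ≤ ∑ d ∈ Icc 1 ⌊R⌋₊, |(μ d : ℝ) * Real.log (R / d) ^ (#H + ℓ) *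
          #((Icc 1 N).filter fun n => d ∣ tuplePoly H n) -
          N * ((μ d : ℝ) * Real.log (R / d) ^ (#H + ℓ) * (nu H d / d : ℝ))| :=
        Finset.abs_sum_le_sum_abs _ _
    _ ≤ ∑ d ∈ Icc 1 ⌊R⌋₊, if Squarefree d then Real.log R ^ (#H + ℓ) * dGen #H d else 0 := by
        refine Finset.sum_le_sum fun d hd => ?_
        obtain ⟨hd1, hdR⟩ := Finset.mem_Icc.1 hd
        have hd0 : (0 : ℝ) < d := by exact_mod_cast hd1
        have hdR' : (d : ℝ) ≤ R := le_trans (by exact_mod_cast hdR) (Nat.floor_le (by linarith))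
        split_ifs with hsq
        · have hfac : (μ d : ℝ) * Real.log (R / d) ^ (#H + ℓ) *
              #((Icc 1 N).filter fun n => d ∣ tuplePoly H n) -
              N * ((μ d : ℝ) * Real.log (R / d) ^ (#H + ℓ) * (nu H d / d : ℝ)) =
              (μ d : ℝ) * Real.log (R / d) ^ (#H + ℓ) *
                ((#((Icc 1 N).filter fun n => d ∣ tuplePoly H n) : ℝ) -
                  nu H d * ((N : ℝ) / d)) := by
            ring
          rw [hfac, abs_mul, abs_mul]
          have hμ : |(μ d : ℝ)| ≤ 1 := by
            rw [← Int.cast_abs]; exact_mod_cast ArithmeticFunction.abs_moebius_le_one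
          have hlog1 : 0 ≤ Real.log (R / d) := Real.log_nonneg ((one_le_div hd0).2 hdR')
          have hlog2 : Real.log (R / d) ≤ Real.log R := by
            rw [Real.log_div (by linarith) hd0.ne']
            linarith [Real.log_nonneg (show (1 : ℝ) ≤ d by exact_mod_cast hd1)]
          have hpow : |Real.log (R / d) ^ (#H + ℓ)| ≤ Real.log R ^ (#H + ℓ) := by
            rw [abs_of_nonneg (pow_nonneg hlog1 _)]
            exact pow_le_pow_left₀ hlog1 hlog2 _
          have hcount := abs_card_filter_dvd_tuplePoly_sub_le hsq H N
          have hν : (nu H d : ℝ) ≤ dGen #H d := by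
            unfold dGen
            have := nu_le_pow H d
            have hω : d.primeFactors.card = ω d := by
              rw [ArithmeticFunction.cardDistinctFactors_apply, Nat.primeFactors,
                List.card_toFinset]
            rw [hω] at this
            exact_mod_cast this
          calc |(μ d : ℝ)| * |Real.log (R / d) ^ (#H + ℓ)| *
                |(#((Icc 1 N).filter fun n => d ∣ tuplePoly H n) : ℝ) - nu H d * ((N : ℝ) / d)|
              ≤ 1 * Real.log R ^ (#H + ℓ) * nu H d := by
                apply mul_le_mul (mul_le_mul hμ hpow (abs_nonneg _) zero_le_one) hcount
                  (abs_nonneg _) (by positivity)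
            _ ≤ Real.log R ^ (#H + ℓ) * dGen #H d := by
                rw [one_mul]; exact mul_le_mul_of_nonneg_left hν (by positivity)
        · have hμ0 : (μ d : ℝ) = 0 := by
            exact_mod_cast ArithmeticFunction.moebius_eq_zero_of_not_squarefree hsq
          rw [hμ0]
          simp
    _ = Real.log R ^ (#H + ℓ) * sumDGen R #H := by
        rw [← Finset.sum_filter, sumDGen, squarefreeLE, Finset.mul_sum]

/-- **GPY (6.5)** with Lemma 2, (5.12) (`Literature.NumberTheory.Sieve.GPY.sumDGen_le`): for `k = #H ≥ 1` and `R ≥ 1`,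
`|S_R(N; H) − N T_R(N; H)| ≤ ((log R)^{k+ℓ}/(k+ℓ)!) · R (k + log R)^k`; for `ℓ = 0` this is the
printed `S_R(N; H) = N T_R(N; H) + O(R (k + log R)^{2k})`.
[cite: GoldstonPintzYildirim2009, Section 6 eq. 6.5] -/
theorem abs_sum_lambdaR_sub_le' {R : ℝ} (hR : 1 ≤ R) {H : Finset ℕ} (hH : H.Nonempty) (ℓ N : ℕ) :
    |∑ n ∈ Icc 1 N, lambdaR R H ℓ n - N * mainTR R H ℓ| ≤
      ((#H + ℓ).factorial : ℝ)⁻¹ * Real.log R ^ (#H + ℓ) * (R * ((#H : ℝ) + Real.log R) ^ #H) := by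
  refine (abs_sum_lambdaR_sub_le hR H ℓ N).trans (mul_le_mul_of_nonneg_left ?_
    (mul_nonneg (by positivity) (pow_nonneg (Real.log_nonneg hR) _)))
  have hk : (0 : ℝ) < #H := by exact_mod_cast hH.card_pos
  have h := sumDGen_le hk hR
  rwa [Nat.ceil_natCast] at h

end Literature.NumberTheory.Sieve.GPY
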